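import Mathlib
import Summits.ValiantsHypothesis.ValiantsHypothesis.Theorems.ProofCarryingSymmetryRestorationQPESatHom

/-!
# Route ProofCarryingSymmetry — crux `RestorationQP`, line `registered`: e-saturated normal forms, part 5 —
the semantic Church–Rosser theorem for one generic ground distributivity instance

Support file for the crux item `stmt-ValiantsHypothesis-10343` (lead c5, cycle 5), continuing
`…ESatHom`.  For a GENERIC instance `d` (`d.Generic`: each of `P`, `Q`, `R` keeps a variable leaf
after constant folding):

* small normal forms are fixed by the e-saturation (`esat_eq_self_of_nvars_lt`), so the normal
  pieces `p, q, r` of the instance are e-inert;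
* BOTH SIDES OF THE GROUND EQUATION SATURATE TO THE EXPANSION: `esat d (p·(q+r)) = sig`
  (one copy of the pattern peels, `Generic.esat_lhs`) and `esat d (p·q + p·r) = sig` (nothing
  peels, `Generic.esat_rhs`);
* the **semantic Church–Rosser theorem** (registered stub `esat_acEq_of_ucEqWith`):
  `UCEqWith d.eqn F G → ACEq (esat d F) (esat d G)` — formulas congruent modulo A1–A5, A7–A10 and
  the ONE ground equation `P·(Q+R) = P·Q + P·R` (usable any number of times, in both directions,
  under arbitrary contexts) have AC-equivalent e-saturated normal forms.  No termination or
  confluence argument is needed: `esat d` is a homomorphism into an algebra of saturated normal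
  forms in which the fragment's axioms AND the ground equation hold up to AC.

With equivariance (`esat_rename`, p170250), evaluation and reach bounds (next parts) this yields
stability at distributivity budget one for an invariant generic instance.  Everything is proved.
-/

-- single-problem summit: `Summit.ValiantsHypothesis.ValiantsHypothesis.…` is the namespace by design (D-0017)
set_option linter.dupNamespace false

noncomputable section

open scoped Classical

namespace Summit.ValiantsHypothesis.ValiantsHypothesis.Theorems

namespace ACStability

open Literature.Computability.AlgebraicComplexity ACClass

universe u v

variable {𝔽 : Type u} [Field 𝔽] {X : Type v} {d : DistData 𝔽 X}

/-! ### Small normal forms are e-inert -/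

/-- **A normal form with fewer variable leaves than the pattern is fixed by the e-saturation.**
[folklore] -/
theorem esat_eq_self_of_nvars_lt (d : DistData 𝔽 X) {x : PIFormula 𝔽 X} (hx : NF x) (h : nvars x < d.patVars) :
    esat d x = x := by
  induction x with
  | var y => rfl
  | const c => rfl
  | add a b iha ihb =>
    obtain ⟨hl, ha, hb⟩ := nf_add_iff.1 hx
    rw [esat_add, iha ha (lt_of_le_of_lt (by simp) h), ihb hb (lt_of_le_of_lt (by simp) h)]
    exact sadd_eq_of_localNF hl
  | mul a b iha ihb =>
    obtain ⟨hl, ha, hb⟩ := nf_mul_iff.1 hx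
    rw [esat_mul, iha ha (lt_of_le_of_lt (by simp) h), ihb hb (lt_of_le_of_lt (by simp) h), emul,
      smul_eq_of_localNF hl]
    exact epeel_of_saturated (kmax_mset_eq_zero_of_nvars_lt d h)

namespace DistData

/-- `p` is e-inert. [folklore] -/
theorem Generic.esat_p (hg : d.Generic) : esat d d.p = d.p :=
  esat_eq_self_of_nvars_lt d d.nf_p (by
    unfold DistData.patVars; rw [d.nvars_s]; have := hg.2.1; omega)

/-- `q` is e-inert. [folklore] -/
theorem Generic.esat_q (hg : d.Generic) : esat d d.q = d.q :=
  esat_eq_self_of_nvars_lt d d.nf_q (by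
    unfold DistData.patVars; rw [d.nvars_s]; have := hg.1; omega)

/-- `r` is e-inert. [folklore] -/
theorem Generic.esat_r (hg : d.Generic) : esat d d.r = d.r :=
  esat_eq_self_of_nvars_lt d d.nf_r (by
    unfold DistData.patVars; rw [d.nvars_s]; have := hg.1; omega)

/-! ### Both sides of the ground equation saturate to the expansion -/

/-- The pure summand of a normal form with a variable leaf is present. [folklore] -/
theorem asplit_fst_isSome_of_nvars {a : PIFormula 𝔽 X} (ha : NF a) (ha1 : 1 ≤ nvars a) :
    ∃ m, (asplit a).1 = some m := by
  cases hm : (asplit a).1 with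
  | some m => exact ⟨m, rfl⟩
  | none =>
    exfalso
    have := ha.amk_asplit
    rw [hm] at this
    rw [← this] at ha1
    simp at ha1

/-- For a generic instance `s = cnorm (Q+R)` is a sum node. [folklore] -/
theorem Generic.s_shape (hg : d.Generic) : constOf d.s = none ∧ headLabel d.s ≠ .mul := by
  obtain ⟨mq, hq⟩ := asplit_fst_isSome_of_nvars d.nf_q hg.2.1
  obtain ⟨mr, hr⟩ := asplit_fst_isSome_of_nvars d.nf_r hg.2.2
  have : d.s = amk (some (.add mq mr)) ((asplit d.q).2 + (asplit d.r).2) := by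
    rw [DistData.s, sadd_def, hq, hr, amerge_some_some]
  rw [this]
  by_cases hc : (asplit d.q).2 + (asplit d.r).2 = 0
  · rw [hc, amk_some_zero]; simp
  · rw [amk_some_of_ne _ hc]; simp

/-- The root factors of `s` are `s` itself, with root constant `1`. [folklore] -/
theorem Generic.margs_s (hg : d.Generic) : margs d.s = [d.s] ∧ mcst d.s = 1 :=
  margs_of_ne hg.s_shape.1 hg.s_shape.2

/-- The pattern is the root factor classes of `p` plus the class of `s`. [folklore] -/
theorem pat_eq : d.pat = mset d.p + {ACClass.mk d.s} := by
  rw [DistData.pat, DistData.patF, List.map_append, ← Multiset.coe_add, mset_def]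
  rfl

/-- **The left side peels once: `esat d (p·(q+r)) = sig`.** [folklore] -/
theorem Generic.esat_lhs (hg : d.Generic) : esat d (.mul d.p (.add d.q d.r)) = d.sig := by
  rw [esat_mul, esat_add, hg.esat_p, hg.esat_q, hg.esat_r, ← DistData.s, emul]
  -- the smart product `p · s`
  have hps0 : mcst d.p * mcst d.s ≠ 0 := by rw [hg.margs_s.2, mul_one]; exact hg.cP_ne_zero
  obtain ⟨hm1, hm2⟩ := mset_smul d.nf_p d.nf_s hps0
  have hl : margs (smul d.p d.s) = d.patF ++ [d.s] := by
    rw [margs_smul d.nf_p d.nf_s hps0, hg.margs_s.1]; rfl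
  have hset : mset (smul d.p d.s) = d.pat := by
    rw [hm1, pat_eq, mset_def d.s, hg.margs_s.1]; rfl
  have hk : kmax (mset (smul d.p d.s)) d.pat = 1 := by rw [hset]; exact kmax_self d.pat_ne_zero
  have hrem : removeBy (d.patF ++ [d.s]) d.pat = [] := by
    apply List.eq_nil_of_length_eq_zero
    have h := length_removeBy_add (d.patF ++ [d.s]) (M := d.pat) (by rw [← hl, ← mset_def, hset])
    have : Multiset.card d.pat = (d.patF ++ [d.s]).length := by
      rw [DistData.pat, Multiset.coe_card, List.length_map]
    omega
  rw [epeel_of_kmax_ne_zero d (by rw [hk]; exact one_ne_zero), hk, hl, one_nsmul, hrem, List.nil_append,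
    List.replicate_one, olist_cons, prodL_nil, hm2, hg.margs_s.2, mul_one, pow_one]
  show mmk (some d.sig) (d.cP * d.cP⁻¹) = d.sig
  rw [mul_inv_cancel₀ hg.cP_ne_zero, mmk_some_one]

/-- **The right side does not peel: `esat d (p·q + p·r) = sig`.** [folklore] -/
theorem Generic.esat_rhs (hg : d.Generic) : esat d (.add (.mul d.p d.q) (.mul d.p d.r)) = d.sig := by
  rw [esat_add, esat_mul, esat_mul, hg.esat_p, hg.esat_q, hg.esat_r, hg.emul_p_q.1, hg.emul_p_q.2]
  rfl

/-- The ground equation is congruent, in the distributivity-free fragment, to the equation between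
the normal pieces. [folklore] -/
theorem ucEq_eqn_pieces (d : DistData 𝔽 X) :
    UCEq d.eqn.1 (.mul d.p (.add d.q d.r)) ∧ UCEq d.eqn.2 (.add (.mul d.p d.q) (.mul d.p d.r)) :=
  ⟨.mul_congr (ucEq_cnorm d.P) (.add_congr (ucEq_cnorm d.Q) (ucEq_cnorm d.R)),
    .add_congr (.mul_congr (ucEq_cnorm d.P) (ucEq_cnorm d.Q)) (.mul_congr (ucEq_cnorm d.P) (ucEq_cnorm d.R))⟩

/-- **Both sides of the ground equation have AC-equivalent (indeed equal) e-saturations.**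
[folklore] -/
theorem Generic.acEq_esat_eqn (hg : d.Generic) : ACEq (esat d d.eqn.1) (esat d d.eqn.2) := by
  have h1 := acEq_esat_of_ucEq hg (ucEq_eqn_pieces d).1
  have h2 := acEq_esat_of_ucEq hg (ucEq_eqn_pieces d).2
  rw [hg.esat_lhs] at h1
  rw [hg.esat_rhs] at h2
  exact h1.trans h2.symm

end DistData

/-! ### The semantic Church–Rosser theorem -/

/-- **Semantic Church–Rosser for one generic ground distributivity instance.**  Formulas congruent
modulo A1–A5, A7–A10 and the ground equation `d.eqn : P·(Q+R) = P·Q + P·R` have AC-equivalent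
e-saturated normal forms. [folklore] -/
theorem acEq_esat_of_ucEqWith (hg : d.Generic) {F G : PIFormula 𝔽 X} (h : UCEqWith d.eqn F G) :
    ACEq (esat d F) (esat d G) := by
  induction h with
  | base h => exact acEq_esat_of_ucEq hg h
  | inst => exact hg.acEq_esat_eqn
  | symm _ ih => exact ih.symm
  | trans _ _ ih₁ ih₂ => exact ih₁.trans ih₂
  | add_congr _ _ ih₁ ih₂ =>
    rw [esat_add, esat_add]
    exact sadd_congr (nf_esat hg _) (nf_esat hg _) (nf_esat hg _) (nf_esat hg _) ih₁ ih₂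
  | mul_congr _ _ ih₁ ih₂ =>
    rw [esat_mul, esat_mul]
    exact emul_congr hg (nf_esat hg _) (nf_esat hg _) (nf_esat hg _) (nf_esat hg _) ih₁ ih₂

/-- The same on classes. [folklore] -/
theorem mk_esat_eq_of_ucEqWith (hg : d.Generic) {F G : PIFormula 𝔽 X} (h : UCEqWith d.eqn F G) :
    mk (esat d F) = mk (esat d G) :=
  mk_eq_mk.2 (acEq_esat_of_ucEqWith hg h)

end ACStability

open Literature.Computability.AlgebraicComplexity in
/-- **Semantic Church–Rosser for one generic ground distributivity instance** (registered stub of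
the line `registered` of crux `RestorationQP`, item stmt-ValiantsHypothesis-10343, rung S3^(1)-inv):
for a generic instance `d` — each of `P`, `Q`, `R` keeps a variable leaf after constant folding —
formulas congruent modulo the distributivity-free fragment of `P_f` (A1–A5, A7–A10, R1–R4) AND the
ground equation `P·(Q+R) = P·Q + P·R` have AC-equivalent e-saturated normal forms
(`ACStability.acEq_esat_of_ucEqWith`). [folklore] -/
theorem esat_acEq_of_ucEqWith : ∀ {𝔽 : Type} [Field 𝔽] {X : Type} (d : ACStability.DistData 𝔽 X), d.Generic → ∀ {F G : PIFormula 𝔽 X}, ACStability.UCEqWith d.eqn F G → ACStability.ACEq (ACStability.esat d F) (ACStability.esat d G) :=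
  fun _ hg _ _ h => ACStability.acEq_esat_of_ucEqWith hg h

end Summit.ValiantsHypothesis.ValiantsHypothesis.Theorems

end
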